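import Summits.QuantumFields.YangMills.Theorems.BalabanUVNodesN13Cor3AsymJunctionAllSmallAtRecord13CoPH
import Literature.MathematicalPhysics.QuantumFieldTheory.Balaban1983to89.B16Improved189ArbitraryRegionFull

/-!
# BalabanUVNodes ∕ N13 — THE COR.-3 CHAIN's END AT NODE 00's STAGE-13 RECORD WITH ASYMMETRIC (2.49) BINDERS **AND THE PRINTED BUDGET**: dag-n13-w3's
# `uvIneq_at_record₁₃CoPH_of_gas_asym` (p589816) with its factor leaves `hZ` ∕ `hY` SUPPLIED from per-component (1.79) ∕ (1.80) ∕ (1.80)⁺ budget data by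
# `B16Improved189ArbitraryRegionFull.{hZ_full_of_budget_torus, hY_full_of_controlsT_torus}` (p585233) at the printed constant `c 0 = c 1 = c₀ = 2(1+β₀)⁻¹p₀(g_k)`;
# and the N11 → N13 edge END TO END at the record: the UPPER (2.49) half at every `V` and the LOWER half on the support PRODUCED BY NAME from dag-n11-w2's
# «[III] Theorem 2 at the record» through dag-n13-w3's §4 ∕ part 2, modulo the two displayed object-level seams `hA'eq` ∕ `hφ1`
# (Track A, DAG node N13 = [B16]; cluster K1 — K1⁷ `StabilityBAtRecordR13SepCoPH` = stmt-QuantumFields-20542, helper `--as helper`; seat `pub-ymgap-dag-n13-w2` g2, own-lineage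
# successor of g0's p592423 (the SYMMETRIC-binder record junction with the full budget); 2026-08-28; count-neutral)

[B16] = T. Bałaban, *Large field renormalization. II. Localization, exponentiation, and bounds for the 𝐑 operation*, Commun. Math. Phys. **122** (1989) 355–392
[Balaban1989LargeFieldII] ((0.1) p. 356, (1.72) p. 379, (1.80) p. 384, p. 387 ll. 21–27, p. 391); [III] = [Balaban1988Convergent] Thm 2 (2.43)–(2.44) p. 263, (2.45)–(2.50) pp. 263–264.

statement-level bookkeeping of a published proof with citation tags; proofs kernel-checked; nothing here is a claim about the Yang–Mills mass gap

CITATION HEADER.  [B16] p. 387 [PDF 33] ll. 21–27 (text layer): *"… hence also an improved bound (1.89), with the additional term −κ₁d_k(X) in the exponential. This implies the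
inequality (2.50) [III], hence Corollary 3."*  [III] p. 264: *"These bounds yield the following bounds for the whole effective action A_k: … (2.49)"*.

WHY THIS FILE.  The record-level END of the Cor.-3 chain exists in two binder shapes: module 36 §4 `B16NodeKnitRecord13CoPH.uvIneq_at_record₁₃CoPH_of_gas` (n24-c; (2.49) TWO-SIDED at
every `V` — `h249`) and dag-n13-w3's `…N13Cor3AsymJunctionAtRecord13CoPH.uvIneq_at_record₁₃CoPH_of_gas_asym` (p589816; `h249up` at every `V`, `h249low` ∕ `hlog` ONLY on `{χ^{(2.9)}_k ≠ 0}` — the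
shape [III] Theorem 2 at the record actually serves, dag-n13-w3's located point LP-1).  g0 of this seat plugged the FULL-budget suppliers of the factor leaves into the FIRST shape
(`B16NodeKnitRecord13CoPHCor3FullBudget.uvIneq_at_record₁₃CoPH_of_fullBudget_of_gas`, p592423).  THIS FILE does the same for the SECOND (asymmetric) shape — so that the END theorem the
N11 → N13 junction feeds reads the PRINTED constant `2(1+β₀)⁻¹p₀(g_k)` with the `−κ₁d_k(X)` improvement, not abstract leaves — and then ASSEMBLES the junction at every configuration:
`h249up` from dag-n13-w3's §4 `ineq249up_at_record₁₃CoPH_of_thm2_of_aPrimeEq` and `h249low` from part 2's `ineq249low_at_record₁₃CoPH_of_thm2_of_phi_eq_one_of_aPrimeEq`, both over dag-n11-w2's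
Theorem-2-at-the-record sentences evaluated at the background of record `U_k(V)`, with the histories ∕ term values ∕ fluctuation arguments `s V`, `t V`, `a V` indexed by the configuration.

WHAT THIS FILE PROVES (theorems only, 0 `def`, 0 `sorry`; BY NAME over p589816 ∕ p591353 ∕ p585233 — nothing re-proved).
§1 run level (abstract `B16.RunData`): `uvIneq_of_repr172_torus_of_ineq249Asym_of_gas_of_fullBudget` — p589816 §2's one call with `hZ` ∕ `hY` replaced by the per-component data.
§2 record level: ★ `uvIneq_at_record₁₃CoPH_of_gas_asym_of_fullBudget` — p589816 §3's END at `(datumOfRecord₁₃CoPH F N θ h).C P` with the same replacement (`hA0` discharged there);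
   `uvIneq_at_record₁₃CoPH_of_gas_asym_of_fullBudget_two` — the entropy term rewritten `M₁⁻⁴·K₀(64,8)·(2e^{−c₀})`.
§3 ★★ `uvIneq_at_record₁₃CoPH_of_thm2_of_fullBudget` — THE N11 → N13 EDGE END TO END AT THE RECORD WITH THE PRINTED BUDGET: (0.1) ∕ (2.50) at every `V` of level `k` of the run `P` from
   [III] Theorem 2's sentences at the record (V-indexed: `h243` (2.43)_j, `h244` (2.44)_j — the large-field 𝐑-operation sentence —, `h248` (2.48), `hφ` `φ_j ≤ 1`, the seam `hA'eq`;
   uniform: `hβj`, `hsum`, `hsmall`, `hvac`, the constants), the all-small seam `hφ1` ON THE SUPPORT `{χ^{(2.9)}_k(V) ≠ 0}`, the two (1.10)-type sizes of the logarithmic vacuum term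
   `E_k^{log}` (`hlog`, `hlog'`), the volume majorant `hΓ`, the sign `hCA` of Theorem 2's constant `E₁(1−L^{−β})⁻¹ + 1 + 2B₁ + E₂`, the per-component budget data, the (1.90) gas and `hH`.

HONEST SCOPE ∕ A6.  By-name junction, count-neutral, LOCATED: the (1.72) representation `R` of `densOfRecord₁₃` (`hH`) has NO supplier in the tree (n10-w1 evidence #17, LOCATED GAP #1 —
definer-grade object), and the seams `hA'eq` («`R.A′ V` IS print's (2.23) action of record at `U_k(V)` along `s V`») ∕ `hφ1` («on the support the history is all-small») are WHAT that
object is — displayed, not decided; so every theorem here is CONDITIONAL exactly as p589816 ∕ p591353 ∕ p592423 are.  Nothing of Bałaban's is asserted: [III] Theorem 2 and Corollary 3,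
[B16] Theorem 1, the (1.79)-factor forms, (1.80) ∕ (1.80)⁺, the (1.90) gas bounds stay displayed hypotheses; N11 ∕ N13 NOT discharged; K0⁷ ∕ K1⁷ NOT closed; counts UNMOVED (discharged
5∕27 · Track A 5∕28); one finite `𝕋⁴_{L^K}` programme at fixed `ε = L^{−K}`, Bałaban AS PRINTED; R4 closes the conditional finite-𝕋⁴ rung `BalabanLadder.UV` only — the Yang–Mills mass
gap (Clay) is NOT proved by any of this; nothing continuum ∕ ℝ⁴ ∕ OS.  No `def`, no `sorry`, no `instance`, no `notation`.
-/

noncomputable section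

open MeasureTheory
open scoped BigOperators Matrix.Norms.L2Operator

namespace Summit.QuantumFields.YangMills.BalabanUVNodes.N13Cor3AsymJunctionFullBudgetAtRecord13CoPH

open Literature.MathematicalPhysics.QuantumFieldTheory.Balaban1983to89 Step B14.Eq225Concrete B14.LocalCoupling B14Thm2 Finset
open T4Continuum T4DatumAssembly Node00 DagBinding FlowStepRuns
open B16Cor3Ops (PosOp Repr172)
open TreeLengthTorus (tsys proj)
open B13FamilySum (Ineq126 VolBound)
open B16Eq190Resummation (bracket mayerTerm F191 polys190 LocalOps DepOn)
open B13ScaleTransfer (Pt FaceConnected)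
open TreeLength (treeLen)
open B16SProfile (Sop)
open B13Factor210Literal (fineCubes)
open B16Improved189ArbitraryRegionFull (hZ_full_of_budget_torus hY_full_of_controlsT_torus)
open Summit.QuantumFields.YangMills.BalabanUVNodes.N13Cor3AsymJunctionAtRecord13CoPH
  (uvIneq_of_repr172_torus_of_ineq249Asym_of_gas uvIneq_at_record₁₃CoPH_of_gas_asym ineq249up_at_record₁₃CoPH_of_thm2_of_aPrimeEq)
open Summit.QuantumFields.YangMills.BalabanUVNodes.N13Cor3AsymJunctionAllSmallAtRecord13CoPH
  (ineq249low_at_record₁₃CoPH_of_thm2_of_phi_eq_one_of_aPrimeEq)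

/-! ## §1. Run level: the Cor.-3 chain's torus one call with ASYMMETRIC (2.49) binders and the factor leaves SUPPLIED from the printed budget -/

section Run

variable (D : B16.RunData) (k : ℕ)

/-- **(0.1) ∕ (2.50), ONE RUN, ONE STEP, ON THE TORUS — ASYMMETRIC (2.49) BINDERS, FULL PRINTED BUDGET**: dag-n13-w3's `uvIneq_of_repr172_torus_of_ineq249Asym_of_gas`
(dimension 4) with `hZ` SUPPLIED by `hZ_full_of_budget_torus` (components of `Z_k`: lifts `X₀`, horizons `K ≥ 1`, budgets `κ` with the (1.79)-factor form `𝐓 1 ≤ exp(−κ − P)`,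
(1.80) `Controls b k K κ s`, profiles `s_{k+1} = treeLen (Sop q X₀)`, `c₀ ≤ P`; dictionary `R·q = Lb·R_{k+1}`, doubled slope clause) and `hY` by `hY_full_of_controlsT_torus` (domains
`Y_i`: lifts `SY`, budgets with the factor form, (1.80)⁺ at horizon 0 `Controls b k 0 (κY − κ₁·d) sY`, `c₀ ≤ PY`), constants `c 0 = c 1 = c₀`; every other binder (the (1.72) datum
`hH`, χ-dictionary, the (1.90) gas, the cube count, `h249up` at every `V`, `h249low` ∕ `hlog` on the support of `χ_k`, `hlog'`, the volume majorant, `hA0`) and the conclusion VERBATIM,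
the entropy term reading `M⁻⁴·K₀(64,8)·Σ_{i<2} e^{−c₀}`.  CONDITIONAL on every input; nothing of Bałaban's asserted.
[cite: Balaban1989LargeFieldII, (0.1) p.356, (1.72) p.379, (1.80) p.384, p.387 ll.21–27; Balaban1988Convergent, (2.49)–(2.50) p.264] -/
theorem uvIneq_of_repr172_torus_of_ineq249Asym_of_gas_of_fullBudget (N : ℕ) [NeZero N] (R : Repr172 (D.Cfg k) (tsys 4 N).Dom)
    {M : ℝ} (hM : M ≠ 0) (hnum : (D.numSites k : ℝ) = (M * N) ^ 4)
    {κ₁ : ℝ} (hκ : B12TreeDecay.kappa₀ (4 * 2 ^ 4) (2 * 4) ≤ κ₁) (hκ₁ : 0 ≤ κ₁) (c₀ : ℝ)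
    (hH : R.Holds (D.ρ k))
    (hχ01 : ∀ a V, 0 ≤ R.χ a V ∧ R.χ a V ≤ 1)
    (h0χ : ∀ V, R.χ R.allSmall V = D.χ k V)
    -- the components of `Z_k`: composite structure and per-component (1.79)/(1.80) data, replacing `hZ`
    (T : R.Adm → (tsys 4 N).Dom → PosOp (D.Cfg k)) (l : R.Adm → List (tsys 4 N).Dom)
    (hnd : ∀ a, (l a).Nodup) (hset : ∀ a, (l a).toFinset = R.Zc a)
    (hTZ : ∀ a Fn V, (R.TZ a).T Fn V = (PosOp.pi (T a) (l a)).T Fn V)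
    (b : Step.Budget.Consts) (Lb : ℝ) {Rk q : ℕ} (hRk : 0 < Rk) (hq : 0 < q)
    (hC : 0 ≤ b.C) (hbM : 0 ≤ b.M) (hRm : ∀ m, 0 ≤ b.R m) (hdim : b.d = 4)
    (hRq : ((Rk * q : ℕ) : ℝ) = Lb * b.R (k + 1)) (hLb : 0 ≤ Lb)
    (hslope2 : 2 * (κ₁ * (4 * 2 ^ 4) * Lb ^ b.d) ≤ b.C * b.M ^ b.d * b.R (k + 1))
    (X₀ : R.Adm → (tsys 4 N).Dom → Finset (Pt 4)) (K : R.Adm → (tsys 4 N).Dom → ℕ)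
    (κ Pp : R.Adm → (tsys 4 N).Dom → ℝ) (s : R.Adm → (tsys 4 N).Dom → ℕ → ℝ)
    (hdataZ : ∀ a, ∀ X ∈ R.Zc a, (X₀ a X).Nonempty ∧ FaceConnected (X₀ a X) ∧
      X.1 = (fineCubes Rk (X₀ a X)).image (proj N) ∧ 1 ≤ K a X ∧
      (∀ V, (T a X).T 1 V ≤ Real.exp (-(κ a X) - Pp a X)) ∧ Step.Budget.Controls b k (K a X) (κ a X) (s a X) ∧
      (∀ m, 0 ≤ s a X m) ∧ s a X (k + 1) = treeLen (Sop q (X₀ a X)) ∧ c₀ ≤ Pp a X)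
    -- the domains `Y_i`: composite structure and per-domain (1.80)⁺ horizon-0 data, replacing `hY`
    (TY : R.Adm → (tsys 4 N).Dom → PosOp (D.Cfg k)) (lY : R.Adm → List (tsys 4 N).Dom)
    (hndY : ∀ a, (lY a).Nodup) (hsetY : ∀ a, (lY a).toFinset = R.Ys a)
    (hTYs : ∀ a Fn V, (R.TYs a).T Fn V = (PosOp.pi (TY a) (lY a)).T Fn V)
    (SY : R.Adm → (tsys 4 N).Dom → Finset (Pt 4)) (κY PY : R.Adm → (tsys 4 N).Dom → ℝ)
    (sY : R.Adm → (tsys 4 N).Dom → ℕ → ℝ)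
    (hdataY : ∀ a, ∀ Y ∈ R.Ys a, (SY a Y).Nonempty ∧ FaceConnected (SY a Y) ∧
      Y.1 = (fineCubes Rk (SY a Y)).image (proj N) ∧ (∀ V, (TY a Y).T 1 V ≤ Real.exp (-(κY a Y) - PY a Y)) ∧
      Step.Budget.Controls b k 0 (κY a Y - κ₁ * treeLen (fineCubes Rk (SY a Y))) (sY a Y) ∧ c₀ ≤ PY a Y)
    -- the (1.90) gas of every admissible term (verbatim)
    {LF DomY Cube Var Sv : Type*} [Fintype LF] [Fintype DomY] [Fintype Cube] [DecidableEq LF] [DecidableEq DomY]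
    [DecidableEq Cube] {adjC : Cube → Cube → Prop} [DecidableRel adjC]
    (hrefl : ∀ a, adjC a a) (hsymm : ∀ a b, adjC a b → adjC b a)
    {locX : LF → Finset Cube} {locY : DomY → Finset Cube} {site : Var → Cube} (Yfix : R.Adm → Finset Cube)
    (houtX : ∀ a j, (locX j \ Yfix a).Nonempty) (houtY : ∀ a Y, (locY Y \ Yfix a).Nonempty)
    (Op : R.Adm → Finset LF → ((Var → Sv) → ℂ) →+ ((Var → Sv) → ℂ))
    (hOps : ∀ a, LocalOps adjC locX (Yfix a) site (Op a))
    (hOpReal : ∀ a (S : Finset LF) (f : (Var → Sv) → ℂ), (∀ ψ, (f ψ).im = 0) → ∀ φ, (Op a S f φ).im = 0)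
    (Vt : R.Adm → DomY → (Var → Sv) → ℂ) (hV : ∀ a Y, DepOn (Yfix a) site (Vt a Y) (locY Y))
    (hVreal : ∀ a Y ψ, (Vt a Y ψ).im = 0) (cfg : D.Cfg k → (Var → Sv))
    {nbr : Cube → Finset Cube} (hnbr : ∀ a b, adjC a b → a ∈ nbr b) {ν : ℝ} (hν : ∀ b, ((nbr b).card : ℝ) ≤ ν)
    {d : R.Adm → Finset Cube → ℝ} {c₁ Rr κ₀ K₀ cv τ : ℝ} (hd : ∀ a X, 0 ≤ d a X) (hc₁ : 0 ≤ c₁) (hK₀ : 0 ≤ K₀)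
    (hτ : 0 ≤ τ)
    (h197 : ∀ a V X, ‖F191 adjC locX locY (Yfix a) (mayerTerm (Op a) (Vt a) (cfg V)) X‖ ≤ c₁ * Real.exp (-(Rr * d a X)))
    (h126 : ∀ a, Ineq126 (polys190 adjC locX locY (Yfix a)) (fun X => X \ Yfix a) (d a) κ₀ K₀)
    (hvol : ∀ a, VolBound (polys190 adjC locX locY (Yfix a)) (fun X => X \ Yfix a) (d a) cv)
    (hrate : κ₀ + τ * cv ≤ Rr) (hsmall : c₁ * Real.exp (τ * cv) * K₀ * ν ≤ τ)
    (hjunction : ∀ a V, R.curly a V = (bracket (Op a) (Vt a) (cfg V)).re)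
    {πc : ℝ} (hQ : (Fintype.card Cube : ℝ) ≤ πc * (D.numSites k : ℝ))
    -- (2.49): upper half at every `V`, lower half and lower log bound on the support of `χ_k` (verbatim)
    (logT : D.Cfg k → ℝ) {C cΓ cL cL' : ℝ} {Γ : ℕ → ℝ} (hCC : 0 ≤ C)
    (hΓ : ∑ n ∈ Icc 1 k, Γ n ≤ cΓ * (D.numSites k : ℝ))
    (h249up : ∀ V, R.A' V + 1 / (D.flow.g k) ^ 2 * D.wilsonBG k V - logT V ≤ C * ∑ n ∈ Icc 1 k, Γ n)
    (h249low : ∀ V, D.χ k V ≠ 0 → -(C * ∑ n ∈ Icc 1 k, Γ n) ≤ R.A' V + 1 / (D.flow.g k) ^ 2 * D.wilsonBG k V - logT V)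
    (hlog : ∀ V, D.χ k V ≠ 0 → -(cL * (D.numSites k : ℝ)) ≤ logT V) (hlog' : ∀ V, logT V ≤ cL' * (D.numSites k : ℝ))
    (hA0 : ∀ V, 0 ≤ D.wilsonBG k V) :
    ∀ V : D.Cfg k, B16.UVIneq D k V (C * cΓ + cL + πc * (c₁ * Real.exp (τ * cv) * K₀))
      (C * cΓ + cL' + πc * (c₁ * Real.exp (τ * cv) * K₀) +
        M⁻¹ ^ 4 * B12TreeDecay.K₀ (4 * 2 ^ 4) (2 * 4) * ∑ _i : Fin 2, Real.exp (-c₀)) :=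
  uvIneq_of_repr172_torus_of_ineq249Asym_of_gas D k N R hM hnum hκ (fun _ => c₀) hH hχ01 h0χ
    (hZ_full_of_budget_torus R T l hnd hset hTZ b k c₀ κ₁ Lb hRk hq (by norm_num) hC hbM hRm hdim hRq hκ₁ hLb hslope2 X₀ K κ
      Pp s hdataZ)
    (hY_full_of_controlsT_torus R TY lY hndY hsetY hTYs b k c₀ κ₁ hRk hκ₁ SY κY PY sY hdataY)
    hrefl hsymm Yfix houtX houtY Op hOps hOpReal Vt hV hVreal cfg hnbr hν hd hc₁ hK₀ hτ h197 h126 hvol hrate hsmall hjunction hQ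
    logT hCC hΓ h249up h249low hlog hlog' hA0

end Run

/-! ## §2. Record level: dag-n13-w3's asymmetric END at NODE 00's Stage-13 record with the factor leaves SUPPLIED from the printed budget -/

section AtRecord

variable (F : T4Family) (N : ℕ) [NeZero N]
variable (θ : Stage13HParams F N) (h : θ.Provisos₁₃CoPH F N) (P : B12.RunParams) (k : ℕ)

/-- **★ THE COR.-3 CHAIN's END AT NODE 00's STAGE-13 RECORD, ASYMMETRIC (2.49) BINDERS, FULL PRINTED BUDGET** — dag-n13-w3's `uvIneq_at_record₁₃CoPH_of_gas_asym` (p589816 §3;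
one run `P`, one level `k`, at `D := (datumOfRecord₁₃CoPH F N θ h).C P`: `χ_k = chiβOfRecord₁₃`, `A^η_k = wilsonBGOfRecord θ.εbg`, `g_k = gOfRecord₁₃`, `ρ_k = densOfRecord₁₃`,
`|T₁^{(k)}| = |Site (F.P P.K) k|`; `hA0` discharged there by `wilsonBGOfRecord_nonneg`) with `c := fun _ => c₀` and the factor leaves SUPPLIED: `hZ` from the per-component (1.79) ∕ (1.80)
data of the components of `Z_k` (`hZ_full_of_budget_torus`), `hY` from the per-domain (1.80)⁺ horizon-0 data of the `Y_i` (`hY_full_of_controlsT_torus`); EVERY OTHER BINDER — the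
(1.72) representation `R` of `ρ_k` OF RECORD (`hH`), `hχ01`, `h0χ`, the site count, the (1.90) gas, the cube count, `h249up` at every `V`, `h249low` ∕ `hlog` on `{χ^{(2.9)}_k ≠ 0}`,
`hlog'`, the volume majorant — and the conclusion VERBATIM; entropy term `M₁⁻⁴·K₀(64,8)·Σ_{i<2} e^{−c₀}`, `c₀ = 2(1+β₀)⁻¹p₀(g_k)` in print.  For every proviso edition over the Co
background (their datum IS this one by def-T's `rfl` bridges).  CONDITIONAL on every input (LOCATED: `hH` has no supplier); nothing of Bałaban's asserted; count-neutral.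
[cite: Balaban1989LargeFieldII, (0.1) p.356, (1.72) p.379, (1.80) p.384, p.387 ll.21–27, p.391; Balaban1988Convergent, (2.49)–(2.50) p.264] -/
theorem uvIneq_at_record₁₃CoPH_of_gas_asym_of_fullBudget (Nc : ℕ) [NeZero Nc] (R : Repr172 (GaugeField (F.P P.K) k (SU N)) (tsys 4 Nc).Dom)
    {M₁ : ℝ} (hM : M₁ ≠ 0) (hnum : (Fintype.card (Site (F.P P.K) k) : ℝ) = (M₁ * Nc) ^ 4)
    {κ₁ : ℝ} (hκ : B12TreeDecay.kappa₀ (4 * 2 ^ 4) (2 * 4) ≤ κ₁) (hκ₁ : 0 ≤ κ₁) (c₀ : ℝ)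
    (hH : R.Holds (densOfRecord₁₃ F N θ.toStage13Params P k))
    (hχ01 : ∀ a V, 0 ≤ R.χ a V ∧ R.χ a V ≤ 1)
    (h0χ : ∀ V, R.χ R.allSmall V = chiβOfRecord₁₃ F N θ.toStage13Params P.K (gOfRecord₁₃ F N θ.toStage13Params P) k V)
    -- the components of `Z_k`: composite structure and per-component (1.79)/(1.80) data, replacing `hZ`
    (T : R.Adm → (tsys 4 Nc).Dom → PosOp (GaugeField (F.P P.K) k (SU N))) (l : R.Adm → List (tsys 4 Nc).Dom)
    (hnd : ∀ a, (l a).Nodup) (hset : ∀ a, (l a).toFinset = R.Zc a)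
    (hTZ : ∀ a Fn V, (R.TZ a).T Fn V = (PosOp.pi (T a) (l a)).T Fn V)
    (b : Step.Budget.Consts) (Lb : ℝ) {Rk q : ℕ} (hRk : 0 < Rk) (hq : 0 < q)
    (hC : 0 ≤ b.C) (hbM : 0 ≤ b.M) (hRm : ∀ m, 0 ≤ b.R m) (hdim : b.d = 4)
    (hRq : ((Rk * q : ℕ) : ℝ) = Lb * b.R (k + 1)) (hLb : 0 ≤ Lb)
    (hslope2 : 2 * (κ₁ * (4 * 2 ^ 4) * Lb ^ b.d) ≤ b.C * b.M ^ b.d * b.R (k + 1))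
    (X₀ : R.Adm → (tsys 4 Nc).Dom → Finset (Pt 4)) (K : R.Adm → (tsys 4 Nc).Dom → ℕ)
    (κ Pp : R.Adm → (tsys 4 Nc).Dom → ℝ) (s : R.Adm → (tsys 4 Nc).Dom → ℕ → ℝ)
    (hdataZ : ∀ a, ∀ X ∈ R.Zc a, (X₀ a X).Nonempty ∧ FaceConnected (X₀ a X) ∧
      X.1 = (fineCubes Rk (X₀ a X)).image (proj Nc) ∧ 1 ≤ K a X ∧
      (∀ V, (T a X).T 1 V ≤ Real.exp (-(κ a X) - Pp a X)) ∧ Step.Budget.Controls b k (K a X) (κ a X) (s a X) ∧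
      (∀ m, 0 ≤ s a X m) ∧ s a X (k + 1) = treeLen (Sop q (X₀ a X)) ∧ c₀ ≤ Pp a X)
    -- the domains `Y_i`: composite structure and per-domain (1.80)⁺ horizon-0 data, replacing `hY`
    (TY : R.Adm → (tsys 4 Nc).Dom → PosOp (GaugeField (F.P P.K) k (SU N))) (lY : R.Adm → List (tsys 4 Nc).Dom)
    (hndY : ∀ a, (lY a).Nodup) (hsetY : ∀ a, (lY a).toFinset = R.Ys a)
    (hTYs : ∀ a Fn V, (R.TYs a).T Fn V = (PosOp.pi (TY a) (lY a)).T Fn V)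
    (SY : R.Adm → (tsys 4 Nc).Dom → Finset (Pt 4)) (κY PY : R.Adm → (tsys 4 Nc).Dom → ℝ)
    (sY : R.Adm → (tsys 4 Nc).Dom → ℕ → ℝ)
    (hdataY : ∀ a, ∀ Y ∈ R.Ys a, (SY a Y).Nonempty ∧ FaceConnected (SY a Y) ∧
      Y.1 = (fineCubes Rk (SY a Y)).image (proj Nc) ∧ (∀ V, (TY a Y).T 1 V ≤ Real.exp (-(κY a Y) - PY a Y)) ∧
      Step.Budget.Controls b k 0 (κY a Y - κ₁ * treeLen (fineCubes Rk (SY a Y))) (sY a Y) ∧ c₀ ≤ PY a Y)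
    -- the (1.90) gas of every admissible term (verbatim)
    {LF DomY Cube Var Sv : Type*} [Fintype LF] [Fintype DomY] [Fintype Cube] [DecidableEq LF] [DecidableEq DomY]
    [DecidableEq Cube] {adjC : Cube → Cube → Prop} [DecidableRel adjC]
    (hrefl : ∀ a, adjC a a) (hsymm : ∀ a b, adjC a b → adjC b a)
    {locX : LF → Finset Cube} {locY : DomY → Finset Cube} {site : Var → Cube} (Yfix : R.Adm → Finset Cube)
    (houtX : ∀ a j, (locX j \ Yfix a).Nonempty) (houtY : ∀ a Y, (locY Y \ Yfix a).Nonempty)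
    (Op : R.Adm → Finset LF → ((Var → Sv) → ℂ) →+ ((Var → Sv) → ℂ))
    (hOps : ∀ a, LocalOps adjC locX (Yfix a) site (Op a))
    (hOpReal : ∀ a (S : Finset LF) (f : (Var → Sv) → ℂ), (∀ ψ, (f ψ).im = 0) → ∀ φ, (Op a S f φ).im = 0)
    (Vt : R.Adm → DomY → (Var → Sv) → ℂ) (hV : ∀ a Y, DepOn (Yfix a) site (Vt a Y) (locY Y))
    (hVreal : ∀ a Y ψ, (Vt a Y ψ).im = 0) (cfg : GaugeField (F.P P.K) k (SU N) → (Var → Sv))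
    {nbr : Cube → Finset Cube} (hnbr : ∀ a b, adjC a b → a ∈ nbr b) {νn : ℝ} (hν : ∀ b, ((nbr b).card : ℝ) ≤ νn)
    {d : R.Adm → Finset Cube → ℝ} {c₁ Rr κ₀ K₀ cv τ : ℝ} (hd : ∀ a X, 0 ≤ d a X) (hc₁ : 0 ≤ c₁) (hK₀ : 0 ≤ K₀)
    (hτ : 0 ≤ τ)
    (h197 : ∀ a V X, ‖F191 adjC locX locY (Yfix a) (mayerTerm (Op a) (Vt a) (cfg V)) X‖ ≤ c₁ * Real.exp (-(Rr * d a X)))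
    (h126 : ∀ a, Ineq126 (polys190 adjC locX locY (Yfix a)) (fun X => X \ Yfix a) (d a) κ₀ K₀)
    (hvol : ∀ a, VolBound (polys190 adjC locX locY (Yfix a)) (fun X => X \ Yfix a) (d a) cv)
    (hrate : κ₀ + τ * cv ≤ Rr) (hsmall : c₁ * Real.exp (τ * cv) * K₀ * νn ≤ τ)
    (hjunction : ∀ a V, R.curly a V = (bracket (Op a) (Vt a) (cfg V)).re)
    {πc : ℝ} (hQ : (Fintype.card Cube : ℝ) ≤ πc * (Fintype.card (Site (F.P P.K) k) : ℝ))
    -- (2.49): upper half at every `V`, lower half and lower log bound on the support of `χ^{(2.9)}_k` (verbatim)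
    (logT : GaugeField (F.P P.K) k (SU N) → ℝ) {CA cΓ cL cL' : ℝ} {Γ : ℕ → ℝ} (hCA : 0 ≤ CA)
    (hΓ : ∑ n ∈ Icc 1 k, Γ n ≤ cΓ * (Fintype.card (Site (F.P P.K) k) : ℝ))
    (h249up : ∀ V, R.A' V + 1 / (gOfRecord₁₃ F N θ.toStage13Params P k) ^ 2 * wilsonBGOfRecord F N θ.εbg P k V - logT V ≤
      CA * ∑ n ∈ Icc 1 k, Γ n)
    (h249low : ∀ V, chiβOfRecord₁₃ F N θ.toStage13Params P.K (gOfRecord₁₃ F N θ.toStage13Params P) k V ≠ 0 →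
      -(CA * ∑ n ∈ Icc 1 k, Γ n) ≤ R.A' V + 1 / (gOfRecord₁₃ F N θ.toStage13Params P k) ^ 2 * wilsonBGOfRecord F N θ.εbg P k V - logT V)
    (hlog : ∀ V, chiβOfRecord₁₃ F N θ.toStage13Params P.K (gOfRecord₁₃ F N θ.toStage13Params P) k V ≠ 0 →
      -(cL * (Fintype.card (Site (F.P P.K) k) : ℝ)) ≤ logT V)
    (hlog' : ∀ V, logT V ≤ cL' * (Fintype.card (Site (F.P P.K) k) : ℝ)) :
    ∀ V : GaugeField (F.P P.K) k (SU N),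
      B16.UVIneq ((datumOfRecord₁₃CoPH F N θ h).C P) k V (CA * cΓ + cL + πc * (c₁ * Real.exp (τ * cv) * K₀))
        (CA * cΓ + cL' + πc * (c₁ * Real.exp (τ * cv) * K₀) +
          M₁⁻¹ ^ 4 * B12TreeDecay.K₀ (4 * 2 ^ 4) (2 * 4) * ∑ _i : Fin 2, Real.exp (-c₀)) :=
  uvIneq_at_record₁₃CoPH_of_gas_asym F N θ h P k Nc R hM hnum hκ (fun _ => c₀) hH hχ01 h0χ
    (hZ_full_of_budget_torus R T l hnd hset hTZ b k c₀ κ₁ Lb hRk hq (by norm_num) hC hbM hRm hdim hRq hκ₁ hLb hslope2 X₀ K κ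
      Pp s hdataZ)
    (hY_full_of_controlsT_torus R TY lY hndY hsetY hTYs b k c₀ κ₁ hRk hκ₁ SY κY PY sY hdataY)
    hrefl hsymm Yfix houtX houtY Op hOps hOpReal Vt hV hVreal cfg hnbr hν hd hc₁ hK₀ hτ h197 h126 hvol hrate hsmall hjunction hQ
    logT hCA hΓ h249up h249low hlog hlog'

/-- The entropy term with the two equal constants summed: `M₁⁻⁴·K₀(64,8)·Σ_{i<2} e^{−c₀} = M₁⁻⁴·K₀(64,8)·(2e^{−c₀})` (print: the two kinds of regions `X ⊂ Z_k`, `Y_i` both carry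
`exp(−2(1+β₀)⁻¹p₀(g_k))`). [cite: Balaban1989LargeFieldII, p.387 ll.21–27 (bookkeeping)] -/
theorem entropy_two (M₁ c₀ : ℝ) :
    M₁⁻¹ ^ 4 * B12TreeDecay.K₀ (4 * 2 ^ 4) (2 * 4) * ∑ _i : Fin 2, Real.exp (-c₀) =
      M₁⁻¹ ^ 4 * B12TreeDecay.K₀ (4 * 2 ^ 4) (2 * 4) * (2 * Real.exp (-c₀)) := by
  simp [Finset.sum_const, Finset.card_univ, Fintype.card_fin]

end AtRecord

/-! ## §3. THE N11 → N13 EDGE END TO END AT THE RECORD WITH THE PRINTED BUDGET: (0.1) ∕ (2.50) at every configuration from [III] Theorem 2's sentences at the record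
(dag-n11-w2) through dag-n13-w3's §4 (upper half) and part 2 (lower half on the support), the per-component budget data, the (1.90) gas and `hH` -/

section EndToEnd

variable (F : T4Family) (N : ℕ) [NeZero N]
variable (θ : Stage13HParams F N) (h : θ.Provisos₁₃CoPH F N) (P : B12.RunParams) (k : ℕ)

/-- **★★ (UV₁₃) AT LEVEL `k` OF THE RUN `P` AT NODE 00's STAGE-13 RECORD FROM [III] THEOREM 2 AT THE RECORD + THE PRINTED BUDGET** — §2's END with BOTH (2.49) binders PRODUCED
BY NAME: `h249up` at every `V` by dag-n13-w3's `ineq249up_at_record₁₃CoPH_of_thm2_of_aPrimeEq`, `h249low` on `{χ^{(2.9)}_k(V) ≠ 0}` by part 2's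
`ineq249low_at_record₁₃CoPH_of_thm2_of_phi_eq_one_of_aPrimeEq`, both over dag-n11-w2's «Theorem 2 at the record» sentences evaluated at the background of record `U_k(V)` with the
history ∕ term values ∕ fluctuation argument `s V`, `t V`, `a V` INDEXED BY THE CONFIGURATION: (2.43)_j `h243`, (2.44)_j `h244` (the large-field 𝐑-operation sentence), (2.48) `h248`,
`φ_j ≤ 1` `hφ`, the seam `hA'eq` («`R.A′ V` IS print's (2.23) action of record at `U_k(V)` along `s V`»); uniform in `V`: `β_j ≥ 0` `hβj`, (2.46)'s coupling inputs `hsum` ∕ `hsmall6`,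
the vacuum sentence `hvac`, `κ₀ ≥ 7`, the constants `E₁ R₁ B₁ L β E₂`, `E_k = E_k^{log} + E_k^{rest}`; ON THE SUPPORT: the all-small seam `hφ1` («every cut-off `φ_j ≡ 1` along `s V`»,
p. 259 ∕ p. 391); the logarithmic vacuum term's (1.10)-type sizes `hlog` ∕ `hlog'` (`logT := −E_k^{log}`, constant in `V`); the volume majorant `hΓ`; the sign `hCA` of Theorem 2's constant
`C_A := E₁(1−L^{−β})⁻¹ + 1 + 2B₁ + E₂`.  Conclusion: `B16.UVIneq ((datumOfRecord₁₃CoPH F N θ h).C P) k V E₋ E₊` at every `V` with `E₋ = C_A·c_Γ + c_L + πc·c₁e^{τc_v}K₀`,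
`E₊ = C_A·c_Γ + c_L′ + πc·c₁e^{τc_v}K₀ + M₁⁻⁴·K₀(64,8)·Σ_{i<2} e^{−c₀}`.  CONDITIONAL on every input — LOCATED (`hH` has no supplier; `hA'eq` ∕ `hφ1` are what `R` is); [III] Theorem 2
∕ Cor. 3 NOT proved; nothing of Bałaban's asserted; N11 ∕ N13 NOT discharged; count-neutral.
[cite: Balaban1988Convergent, Thm 2 (2.43)–(2.44) p.263, (2.45)–(2.50) pp.263–264, (2.24) p.259, p.259; Balaban1989LargeFieldII, (0.1) p.356, (1.72) p.379, (1.80) p.384, p.387 ll.21–27, p.391] -/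
theorem uvIneq_at_record₁₃CoPH_of_thm2_of_fullBudget (Nc : ℕ) [NeZero Nc] (R : Repr172 (GaugeField (F.P P.K) k (SU N)) (tsys 4 Nc).Dom)
    {M₁ : ℝ} (hM : M₁ ≠ 0) (hnum : (Fintype.card (Site (F.P P.K) k) : ℝ) = (M₁ * Nc) ^ 4)
    {κ₁ : ℝ} (hκ : B12TreeDecay.kappa₀ (4 * 2 ^ 4) (2 * 4) ≤ κ₁) (hκ₁ : 0 ≤ κ₁) (c₀ : ℝ)
    (hH : R.Holds (densOfRecord₁₃ F N θ.toStage13Params P k))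
    (hχ01 : ∀ a V, 0 ≤ R.χ a V ∧ R.χ a V ≤ 1)
    (h0χ : ∀ V, R.χ R.allSmall V = chiβOfRecord₁₃ F N θ.toStage13Params P.K (gOfRecord₁₃ F N θ.toStage13Params P) k V)
    -- the components of `Z_k`: composite structure and per-component (1.79)/(1.80) data
    (T : R.Adm → (tsys 4 Nc).Dom → PosOp (GaugeField (F.P P.K) k (SU N))) (l : R.Adm → List (tsys 4 Nc).Dom)
    (hnd : ∀ a, (l a).Nodup) (hset : ∀ a, (l a).toFinset = R.Zc a)
    (hTZ : ∀ a Fn V, (R.TZ a).T Fn V = (PosOp.pi (T a) (l a)).T Fn V)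
    (b : Step.Budget.Consts) (Lb : ℝ) {Rk q : ℕ} (hRk : 0 < Rk) (hq : 0 < q)
    (hC : 0 ≤ b.C) (hbM : 0 ≤ b.M) (hRm : ∀ m, 0 ≤ b.R m) (hdim : b.d = 4)
    (hRq : ((Rk * q : ℕ) : ℝ) = Lb * b.R (k + 1)) (hLb : 0 ≤ Lb)
    (hslope2 : 2 * (κ₁ * (4 * 2 ^ 4) * Lb ^ b.d) ≤ b.C * b.M ^ b.d * b.R (k + 1))
    (X₀ : R.Adm → (tsys 4 Nc).Dom → Finset (Pt 4)) (K : R.Adm → (tsys 4 Nc).Dom → ℕ)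
    (κ Pp : R.Adm → (tsys 4 Nc).Dom → ℝ) (s : R.Adm → (tsys 4 Nc).Dom → ℕ → ℝ)
    (hdataZ : ∀ a, ∀ X ∈ R.Zc a, (X₀ a X).Nonempty ∧ FaceConnected (X₀ a X) ∧
      X.1 = (fineCubes Rk (X₀ a X)).image (proj Nc) ∧ 1 ≤ K a X ∧
      (∀ V, (T a X).T 1 V ≤ Real.exp (-(κ a X) - Pp a X)) ∧ Step.Budget.Controls b k (K a X) (κ a X) (s a X) ∧
      (∀ m, 0 ≤ s a X m) ∧ s a X (k + 1) = treeLen (Sop q (X₀ a X)) ∧ c₀ ≤ Pp a X)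
    -- the domains `Y_i`: composite structure and per-domain (1.80)⁺ horizon-0 data
    (TY : R.Adm → (tsys 4 Nc).Dom → PosOp (GaugeField (F.P P.K) k (SU N))) (lY : R.Adm → List (tsys 4 Nc).Dom)
    (hndY : ∀ a, (lY a).Nodup) (hsetY : ∀ a, (lY a).toFinset = R.Ys a)
    (hTYs : ∀ a Fn V, (R.TYs a).T Fn V = (PosOp.pi (TY a) (lY a)).T Fn V)
    (SY : R.Adm → (tsys 4 Nc).Dom → Finset (Pt 4)) (κY PY : R.Adm → (tsys 4 Nc).Dom → ℝ)
    (sY : R.Adm → (tsys 4 Nc).Dom → ℕ → ℝ)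
    (hdataY : ∀ a, ∀ Y ∈ R.Ys a, (SY a Y).Nonempty ∧ FaceConnected (SY a Y) ∧
      Y.1 = (fineCubes Rk (SY a Y)).image (proj Nc) ∧ (∀ V, (TY a Y).T 1 V ≤ Real.exp (-(κY a Y) - PY a Y)) ∧
      Step.Budget.Controls b k 0 (κY a Y - κ₁ * treeLen (fineCubes Rk (SY a Y))) (sY a Y) ∧ c₀ ≤ PY a Y)
    -- the (1.90) gas of every admissible term (verbatim)
    {LF DomY Cube Var Sv : Type*} [Fintype LF] [Fintype DomY] [Fintype Cube] [DecidableEq LF] [DecidableEq DomY]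
    [DecidableEq Cube] {adjC : Cube → Cube → Prop} [DecidableRel adjC]
    (hrefl : ∀ a, adjC a a) (hsymm : ∀ a b, adjC a b → adjC b a)
    {locX : LF → Finset Cube} {locY : DomY → Finset Cube} {site : Var → Cube} (Yfix : R.Adm → Finset Cube)
    (houtX : ∀ a j, (locX j \ Yfix a).Nonempty) (houtY : ∀ a Y, (locY Y \ Yfix a).Nonempty)
    (Op : R.Adm → Finset LF → ((Var → Sv) → ℂ) →+ ((Var → Sv) → ℂ))
    (hOps : ∀ a, LocalOps adjC locX (Yfix a) site (Op a))
    (hOpReal : ∀ a (S : Finset LF) (f : (Var → Sv) → ℂ), (∀ ψ, (f ψ).im = 0) → ∀ φ, (Op a S f φ).im = 0)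
    (Vt : R.Adm → DomY → (Var → Sv) → ℂ) (hV : ∀ a Y, DepOn (Yfix a) site (Vt a Y) (locY Y))
    (hVreal : ∀ a Y ψ, (Vt a Y ψ).im = 0) (cfg : GaugeField (F.P P.K) k (SU N) → (Var → Sv))
    {nbr : Cube → Finset Cube} (hnbr : ∀ a b, adjC a b → a ∈ nbr b) {νn : ℝ} (hν : ∀ b, ((nbr b).card : ℝ) ≤ νn)
    {d : R.Adm → Finset Cube → ℝ} {c₁ Rr κc K₀ cv τ : ℝ} (hd : ∀ a X, 0 ≤ d a X) (hc₁ : 0 ≤ c₁) (hK₀ : 0 ≤ K₀)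
    (hτ : 0 ≤ τ)
    (h197 : ∀ a V X, ‖F191 adjC locX locY (Yfix a) (mayerTerm (Op a) (Vt a) (cfg V)) X‖ ≤ c₁ * Real.exp (-(Rr * d a X)))
    (h126 : ∀ a, Ineq126 (polys190 adjC locX locY (Yfix a)) (fun X => X \ Yfix a) (d a) κc K₀)
    (hvol : ∀ a, VolBound (polys190 adjC locX locY (Yfix a)) (fun X => X \ Yfix a) (d a) cv)
    (hrate : κc + τ * cv ≤ Rr) (hsmall : c₁ * Real.exp (τ * cv) * K₀ * νn ≤ τ)
    (hjunction : ∀ a V, R.curly a V = (bracket (Op a) (Vt a) (cfg V)).re)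
    {πc : ℝ} (hQ : (Fintype.card Cube : ℝ) ≤ πc * (Fintype.card (Site (F.P P.K) k) : ℝ))
    -- [III] Theorem 2's sentences at the record (dag-n11-w2's binders at `U := U_k(V)`), indexed by the configuration where they must be
    (sV : (V : GaugeField (F.P P.K) k (SU N)) → SeqOfRecord F θ.ν θ.τ9.M (gOfRecord₁₃ F N θ.toStage13Params P) P.K k)
    (tV : GaugeField (F.P P.K) k (SU N) → Sect2.TermValues (F.P P.K) (MatA N) (FluctV N) θ.τ9.M)
    (aV : GaugeField (F.P P.K) k (SU N) → Tk.SFluct (F.P P.K) (FluctV N)) (κ₀ : ℕ) (hκ₀ : 7 ≤ κ₀)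
    (Ek EkLog EkRest : ℝ) (hEk : Ek = EkLog + EkRest) (E₁ R₁ B₁ L β E₂ : ℝ) (Γ : ℕ → ℝ)
    (hL : 1 < L) (hβ : 0 < β) (hE : 0 ≤ E₁) (hR₁ : 0 ≤ R₁) (hΓpos : ∀ n, 1 ≤ n → n ≤ k → 0 ≤ Γ n)
    (hβj : ∀ j, 1 ≤ j → j ≤ k → 0 ≤ 1 / gOfRecord₁₃ F N θ.toStage13Params P (j - 1) ^ 2 - 1 / gOfRecord₁₃ F N θ.toStage13Params P j ^ 2)
    (hφ : ∀ V, ∀ j, 1 ≤ j → j ≤ k → ∀ x, θ.Phih P k (sV V).Ω (sV V).Λ j x ≤ 1)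
    (hφ1 : ∀ V, chiβOfRecord₁₃ F N θ.toStage13Params P.K (gOfRecord₁₃ F N θ.toStage13Params P) k V ≠ 0 →
      ∀ j, 1 ≤ j → j ≤ k → ∀ x, θ.Phih P k (sV V).Ω (sV V).Λ j x = 1)
    (h243 : ∀ V, ∀ j, 1 ≤ j → j ≤ k →
      |EjSub (sect2TowerOfRecord F N (FluctV N) P.K (settingOfRecord₁₃ F N θ.toStage13Params P) (θ.rzAt P (sV V)) (sV V) (tV V))
            (fun j X z => Sect2.admE (F.P P.K) θ.ν θ.τ9.M (gOfRecord₁₃ F N θ.toStage13Params P) (sV V).Λ j (Sect2.domSites (F.P P.K) θ.τ9.M j X) z) j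
            (Uk F N P.K k θ.εbg V)
          - (1 / gOfRecord₁₃ F N θ.toStage13Params P (j - 1) ^ 2 - 1 / gOfRecord₁₃ F N θ.toStage13Params P j ^ 2) *
              smearedWilson (θ.Phih P k (sV V).Ω (sV V).Λ j) (Uk F N P.K k θ.εbg V)| ≤ E₁ * ∑ n ∈ Icc j k, (L ^ ((j : ℝ) - n)) ^ β * Γ n)
    (h244 : ∀ V, ∀ j, 1 ≤ j → j ≤ k →
      |∑ X : (Sect2.domSys (F.P P.K) θ.τ9.M j).Dom, (if Sect2.admR (F.P P.K) θ.ν θ.τ9.M (gOfRecord₁₃ F N θ.toStage13Params P) (sV V).Λ j (Sect2.domSites (F.P P.K) θ.τ9.M j X) then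
          (((tV V).R j X (Sect2.ofBackgroundC (ιSU N) (Uk F N P.K k θ.εbg V))).re - ((tV V).R j X (Sect2.ofBackgroundC (ιSU N) 1)).re) else 0)| ≤
        R₁ * (gOfRecord₁₃ F N θ.toStage13Params P j) ^ κ₀ * ∑ n ∈ Icc j k, Γ n)
    (hsum : ∀ n, 1 ≤ n → n ≤ k → ∑ j ∈ Icc 1 n, (gOfRecord₁₃ F N θ.toStage13Params P j) ^ κ₀ ≤ (gOfRecord₁₃ F N θ.toStage13Params P n) ^ (κ₀ - 6))
    (hsmall6 : ∀ n, 1 ≤ n → n ≤ k → R₁ * (gOfRecord₁₃ F N θ.toStage13Params P n) ^ (κ₀ - 6) ≤ 1)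
    (h248 : ∀ V, |B240 (sect2TowerOfRecord F N (FluctV N) P.K (settingOfRecord₁₃ F N θ.toStage13Params P) (θ.rzAt P (sV V)) (sV V) (tV V))
        (fun j X => Sect2.admB (F.P P.K) θ.ν θ.τ9.M (gOfRecord₁₃ F N θ.toStage13Params P) (sV V).Ω (sV V).Λ j (Sect2.domSites (F.P P.K) θ.τ9.M j X)) (aV V) k
        (Uk F N P.K k θ.εbg V)| ≤ 2 * B₁ * ∑ n ∈ Icc 1 k, Γ n)
    (hvac : VacuumRestBound EkRest E₂ Γ k)
    (hA'eq : ∀ V, R.A' V =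
      (sect2ActionDataOfRecord F N (FluctV N) P.K (settingOfRecord₁₃ F N θ.toStage13Params P) (θ.rzAt P (sV V)) (sV V) (tV V) (aV V) Ek).action23 k
        (Uk F N P.K k θ.εbg V))
    -- the sizes of the logarithmic vacuum term, the volume majorant, the sign of Theorem 2's constant
    {cΓ cL cL' : ℝ} (hCA : 0 ≤ E₁ * (1 - L ^ (-β))⁻¹ + 1 + 2 * B₁ + E₂)
    (hΓ : ∑ n ∈ Icc 1 k, Γ n ≤ cΓ * (Fintype.card (Site (F.P P.K) k) : ℝ))
    (hlog : -(cL * (Fintype.card (Site (F.P P.K) k) : ℝ)) ≤ -EkLog)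
    (hlog' : -EkLog ≤ cL' * (Fintype.card (Site (F.P P.K) k) : ℝ)) :
    ∀ V : GaugeField (F.P P.K) k (SU N),
      B16.UVIneq ((datumOfRecord₁₃CoPH F N θ h).C P) k V
        ((E₁ * (1 - L ^ (-β))⁻¹ + 1 + 2 * B₁ + E₂) * cΓ + cL + πc * (c₁ * Real.exp (τ * cv) * K₀))
        ((E₁ * (1 - L ^ (-β))⁻¹ + 1 + 2 * B₁ + E₂) * cΓ + cL' + πc * (c₁ * Real.exp (τ * cv) * K₀) +
          M₁⁻¹ ^ 4 * B12TreeDecay.K₀ (4 * 2 ^ 4) (2 * 4) * ∑ _i : Fin 2, Real.exp (-c₀)) :=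
  uvIneq_at_record₁₃CoPH_of_gas_asym_of_fullBudget F N θ h P k Nc R hM hnum hκ hκ₁ c₀ hH hχ01 h0χ T l hnd hset hTZ b Lb hRk hq hC hbM hRm
    hdim hRq hLb hslope2 X₀ K κ Pp s hdataZ TY lY hndY hsetY hTYs SY κY PY sY hdataY hrefl hsymm Yfix houtX houtY Op hOps hOpReal Vt hV
    hVreal cfg hnbr hν hd hc₁ hK₀ hτ h197 h126 hvol hrate hsmall hjunction hQ (fun _ => -EkLog) hCA hΓ
    (fun V => ineq249up_at_record₁₃CoPH_of_thm2_of_aPrimeEq F N θ P k R V (sV V) (tV V) (aV V) κ₀ hκ₀ Ek EkLog EkRest hEk E₁ R₁ B₁ L β E₂ Γ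
      hL hβ hE hR₁ hΓpos hβj (hφ V) (h243 V) (h244 V) hsum hsmall6 (h248 V) hvac (hA'eq V))
    (fun V hV => ineq249low_at_record₁₃CoPH_of_thm2_of_phi_eq_one_of_aPrimeEq F N θ P k R V (sV V) (tV V) (aV V) κ₀ hκ₀ Ek EkLog EkRest hEk
      E₁ R₁ B₁ L β E₂ Γ hL hβ hE hR₁ hΓpos (hφ1 V hV) (h243 V) (h244 V) hsum hsmall6 (h248 V) hvac (hA'eq V))
    (fun _ _ => hlog) (fun _ => hlog')

end EndToEnd

end Summit.QuantumFields.YangMills.BalabanUVNodes.N13Cor3AsymJunctionFullBudgetAtRecord13CoPH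

end
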